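import Mathlib
import HarnessLib
import HarnessLib.Audit

/-!
# SoloInformed — the torsion chain, II: the tripling map `σ` (multiplication by `3` on `y² = X³+1`)

In the coordinate `w = 1/(X + 2)` of the CM curve `E : y² = X³ + 1`, the `X`-coordinate of the
multiplication-by-`3` map, `X ↦ N(X)/D(X)` with `N = X⁹ − 96X⁶ + 48X³ + 64`,
`D = 9X²(X³ + 4)²`, becomes the rational self-map of `[0,1]`
`σ(w) = P(w)/(A(w) + P(w))`,  `P = 9w(1 − 2w)²((1 − 2w)³ + 4w³)²`,
`A = (1 − w)(1 − 4w)²((1 − 2w)²(1 + 4w) + 4w³)²`,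
with `σ(0) = 0`, `σ(¼) = 1`, `σ(½) = 0`, `σ(1) = 1` (the `3`-torsion points `X = 0, ∞` sit at
`w = ½, 0`; the `2`-torsion points `X = 2, −1` at `w = ¼, 1`). This file is pure real algebra:
positivity of `P`, `A`, `A + P` on `[0,1]`, the values, the derivative `σ' = Wr/(A + P)²` with
the Wronskian `Wr = P'(A+P) − P(A+P)'` expanded (degree `16`), and the **key polynomial
identity** `Wr² · w((1 − 2w)³ + w³) = 9P((A − P)³ + P³)` (degree `36`, checked by `ring`),
which is the coordinate shadow of `[3]^*ω = 3ω` for the invariant differential `ω = dX/y`.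
Residency `solo-KontsevichZagierPeriods-informed` (s23); paper §6octies (vii).

References: J. H. Silverman, *The Arithmetic of Elliptic Curves*, III.2 (group law),
Ex. 3.7 (division polynomials), III.5.1 (invariant differential); Kontsevich–Zagier,
*Periods* (2001), §1.2.
-/

noncomputable section

open Set
namespace Summit.KontsevichZagierPeriods.KontsevichZagierPeriods.Theorems

/-! ### The tripling map `σ = P/(A + P)` -/

/-- `P(w) = 9w(1 − 2w)²((1 − 2w)³ + 4w³)²` (numerator of `σ`). [this work] -/
def soloInformedTriplingP (w : ℝ) : ℝ :=
  9 * w * (1 - 2 * w) ^ 2 * ((1 - 2 * w) ^ 3 + 4 * w ^ 3) ^ 2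

/-- `A(w) = (1 − w)(1 − 4w)²((1 − 2w)²(1 + 4w) + 4w³)²` (`= denominator − numerator` of `σ`).
[this work] -/
def soloInformedTriplingA (w : ℝ) : ℝ :=
  (1 - w) * (1 - 4 * w) ^ 2 * ((1 - 2 * w) ^ 2 * (1 + 4 * w) + 4 * w ^ 3) ^ 2

/-- The denominator `A + P` of `σ`. [this work] -/
def soloInformedTriplingDen (w : ℝ) : ℝ := soloInformedTriplingA w + soloInformedTriplingP w

/-- **The tripling map** `σ(w) = P(w)/(A(w) + P(w))`: the multiplication-by-`3` isogeny of the
CM curve `y² = X³ + 1` (`X ↦ (X⁹ − 96X⁶ + 48X³ + 64)/(9X²(X³ + 4)²)`) in the coordinate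
`w = 1/(X + 2)`; `σ(0) = 0`, `σ(¼) = 1`, `σ(½) = 0`, `σ(1) = 1`. [Silverman, AEC III.2] -/
def soloInformedTripling (w : ℝ) : ℝ := soloInformedTriplingP w / soloInformedTriplingDen w

/-- The Wronskian `P'(A + P) − P(A + P)'` (numerator of `σ'`), expanded. [this work] -/
def soloInformedTriplingWr (w : ℝ) : ℝ :=
  9 - 288 * w + 4320 * w ^ 2 - 38304 * w ^ 3 + 209664 * w ^ 4
  - 628992 * w ^ 5 - 8064 * w ^ 6 + 10045440 * w ^ 7 - 54825984 * w ^ 8 + 176364288 * w ^ 9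
  - 395168256 * w ^ 10 + 643120128 * w ^ 11 - 760612608 * w ^ 12 + 635701248 * w ^ 13
  - 352733184 * w ^ 14 + 114481152 * w ^ 15 - 15851520 * w ^ 16

/-- `σ' = Wr/(A + P)²`. [this work] -/
def soloInformedTripling' (w : ℝ) : ℝ :=
  soloInformedTriplingWr w / soloInformedTriplingDen w ^ 2

/-- **The key polynomial identity** `Wr² · w((1−2w)³ + w³) = 9P((A + P − 2P)³ + P³)`
(degree `36`; the algebraic shadow of `[3]^*ω = 3ω` for `ω = dX/y`: it says
`σ'(w)² · wQ(w) = 9 · σ Q(σ)` with `Q(w) = (1 − 2w)³ + w³`). [this work] -/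
theorem soloInformed_tripling_ring_identity (w : ℝ) :
    soloInformedTriplingWr w ^ 2 * (w * ((1 - 2 * w) ^ 3 + w ^ 3)) =
      9 * soloInformedTriplingP w *
        ((soloInformedTriplingDen w - 2 * soloInformedTriplingP w) ^ 3 +
          soloInformedTriplingP w ^ 3) := by
  unfold soloInformedTriplingWr soloInformedTriplingDen soloInformedTriplingA
    soloInformedTriplingP
  ring

/-! ### Positivity and values -/

/-- `(1 − 2w)³ + 4w³ > 0` on `[0, 1]`. [this work] -/
theorem soloInformed_tripling_inner₁_pos {w : ℝ} (h0 : 0 ≤ w) (h1 : w ≤ 1) :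
    0 < (1 - 2 * w) ^ 3 + 4 * w ^ 3 := by
  rcases eq_or_lt_of_le h1 with rfl | hlt
  · norm_num
  · have e : (1 - 2 * w) ^ 3 + 4 * w ^ 3 = (1 - w) * (7 * w ^ 2 - 5 * w + 1) + 3 * w ^ 3 := by
      ring
    rw [e]
    have hq : 0 < 7 * w ^ 2 - 5 * w + 1 := by nlinarith [sq_nonneg (w - 5 / 14)]
    exact add_pos_of_pos_of_nonneg (mul_pos (sub_pos.2 hlt) hq) (by positivity)

/-- `(1 − 2w)²(1 + 4w) + 4w³ > 0` for `w ≥ 0`. [this work] -/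
theorem soloInformed_tripling_inner₂_pos {w : ℝ} (h0 : 0 ≤ w) :
    0 < (1 - 2 * w) ^ 2 * (1 + 4 * w) + 4 * w ^ 3 := by
  rcases eq_or_lt_of_le h0 with rfl | hlt
  · norm_num
  · have : 0 < 1 + 4 * w := by linarith
    positivity

/-- `P ≥ 0` for `w ≥ 0`. [this work] -/
theorem soloInformed_triplingP_nonneg {w : ℝ} (h0 : 0 ≤ w) : 0 ≤ soloInformedTriplingP w := by
  unfold soloInformedTriplingP
  positivity

/-- `P > 0` for `w ∈ (0,1]`, `w ≠ ½`. [this work] -/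
theorem soloInformed_triplingP_pos {w : ℝ} (h0 : 0 < w) (h1 : w ≤ 1) (h2 : w ≠ 1 / 2) :
    0 < soloInformedTriplingP w := by
  unfold soloInformedTriplingP
  have h2' : 1 - 2 * w ≠ 0 := fun e => h2 (by linarith)
  have := soloInformed_tripling_inner₁_pos h0.le h1
  positivity

/-- `A ≥ 0` on `[0, 1]`. [this work] -/
theorem soloInformed_triplingA_nonneg {w : ℝ} (h0 : 0 ≤ w) (h1 : w ≤ 1) :
    0 ≤ soloInformedTriplingA w := by
  unfold soloInformedTriplingA
  have : 0 ≤ 1 - w := sub_nonneg.2 h1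
  have := soloInformed_tripling_inner₂_pos h0
  positivity

/-- `A > 0` for `w ∈ [0,1)`, `w ≠ ¼`. [this work] -/
theorem soloInformed_triplingA_pos {w : ℝ} (h0 : 0 ≤ w) (h1 : w < 1) (h4 : w ≠ 1 / 4) :
    0 < soloInformedTriplingA w := by
  unfold soloInformedTriplingA
  have : 0 < 1 - w := sub_pos.2 h1
  have h4' : 1 - 4 * w ≠ 0 := fun e => h4 (by linarith)
  have := soloInformed_tripling_inner₂_pos h0
  positivity

/-- The denominator of `σ` is positive on `[0, 1]`. [this work] -/
theorem soloInformed_triplingDen_pos {w : ℝ} (h0 : 0 ≤ w) (h1 : w ≤ 1) :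
    0 < soloInformedTriplingDen w := by
  unfold soloInformedTriplingDen
  rcases eq_or_lt_of_le h1 with rfl | hlt
  · norm_num [soloInformedTriplingA, soloInformedTriplingP]
  rcases eq_or_ne w (1 / 4) with rfl | h4
  · norm_num [soloInformedTriplingA, soloInformedTriplingP]
  exact add_pos_of_pos_of_nonneg (soloInformed_triplingA_pos h0 hlt h4)
    (soloInformed_triplingP_nonneg h0)

/-- `σ ∈ (0,1)` on `(0,1) ∖ {¼, ½}`. [this work] -/
theorem soloInformed_tripling_mem {w : ℝ} (h0 : 0 < w) (h1 : w < 1) (h4 : w ≠ 1 / 4)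
    (h2 : w ≠ 1 / 2) : soloInformedTripling w ∈ Ioo (0:ℝ) 1 := by
  have hP := soloInformed_triplingP_pos h0 h1.le h2
  have hA := soloInformed_triplingA_pos h0.le h1 h4
  have hD := soloInformed_triplingDen_pos h0.le h1.le
  unfold soloInformedTripling
  refine ⟨div_pos hP hD, (div_lt_one hD).2 ?_⟩
  unfold soloInformedTriplingDen
  linarith

/-- The values `σ(0) = 0`, `σ(¼) = 1`, `σ(½) = 0`, `σ(1) = 1` (torsion points of `E`).
[Silverman, AEC III.2] -/
theorem soloInformed_tripling_values :
    soloInformedTripling 0 = 0 ∧ soloInformedTripling (1 / 4) = 1 ∧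
      soloInformedTripling (1 / 2) = 0 ∧ soloInformedTripling 1 = 1 := by
  refine ⟨?_, ?_, ?_, ?_⟩ <;>
    norm_num [soloInformedTripling, soloInformedTriplingDen, soloInformedTriplingA,
      soloInformedTriplingP]

/-- `σ` maps `(0,¼)` into `(0,1)`. [this work] -/
theorem soloInformed_tripling_mapsTo₁ :
    MapsTo soloInformedTripling (Ioo (0:ℝ) (1 / 4)) (Ioo 0 1) := fun w hw =>
  soloInformed_tripling_mem hw.1 (by linarith [hw.2]) (ne_of_lt hw.2)
    (by intro h; linarith [hw.2])

/-- `σ` maps `(¼,½)` into `(0,1)`. [this work] -/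
theorem soloInformed_tripling_mapsTo₂ :
    MapsTo soloInformedTripling (Ioo (1 / 4 : ℝ) (1 / 2)) (Ioo 0 1) := fun w hw =>
  soloInformed_tripling_mem (by linarith [hw.1]) (by linarith [hw.2]) (ne_of_gt hw.1)
    (ne_of_lt hw.2)

/-- `σ` maps `(½,1)` into `(0,1)`. [this work] -/
theorem soloInformed_tripling_mapsTo₃ :
    MapsTo soloInformedTripling (Ioo (1 / 2 : ℝ) 1) (Ioo 0 1) := fun w hw =>
  soloInformed_tripling_mem (by linarith [hw.1]) hw.2 (by intro h; linarith [hw.1])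
    (ne_of_gt hw.1)

/-! ### The derivative `σ' = Wr/(A + P)²` -/

/-- The derivative of `σ` where `A + P ≠ 0` (in particular on `[0,1]`):
`σ' = (P'(A+P) − P(A+P)')/(A+P)² = Wr/(A+P)²`. [this work] -/
theorem soloInformed_hasDerivAt_tripling {w : ℝ} (hD : soloInformedTriplingDen w ≠ 0) :
    HasDerivAt soloInformedTripling (soloInformedTripling' w) w := by
  have hi := hasDerivAt_id' w
  have hl : HasDerivAt (fun y : ℝ => 1 - 2 * y) (-2) w := by
    simpa using (hi.const_mul (2:ℝ)).const_sub 1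
  have h1y : HasDerivAt (fun y : ℝ => 1 - y) (-1) w := hi.const_sub 1
  have h4y : HasDerivAt (fun y : ℝ => 1 - 4 * y) (-4) w := by
    simpa using (hi.const_mul (4:ℝ)).const_sub 1
  have h4y' : HasDerivAt (fun y : ℝ => 1 + 4 * y) 4 w := by
    simpa using (hi.const_mul (4:ℝ)).const_add 1
  have hin₁ := (hl.fun_pow 3).fun_add ((hi.fun_pow 3).const_mul (4:ℝ))
  have hP := ((hi.const_mul (9:ℝ)).fun_mul (hl.fun_pow 2)).fun_mul (hin₁.fun_pow 2)
  have hin₂ := ((hl.fun_pow 2).fun_mul h4y').fun_add ((hi.fun_pow 3).const_mul (4:ℝ))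
  have hA := (h1y.fun_mul (h4y.fun_pow 2)).fun_mul (hin₂.fun_pow 2)
  have hσ := hP.fun_div (hA.fun_add hP) hD
  have hfun : soloInformedTripling = fun y : ℝ =>
      9 * y * (1 - 2 * y) ^ 2 * ((1 - 2 * y) ^ 3 + 4 * y ^ 3) ^ 2 /
        ((1 - y) * (1 - 4 * y) ^ 2 * ((1 - 2 * y) ^ 2 * (1 + 4 * y) + 4 * y ^ 3) ^ 2 +
          9 * y * (1 - 2 * y) ^ 2 * ((1 - 2 * y) ^ 3 + 4 * y ^ 3) ^ 2) := rfl
  rw [hfun]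
  refine hσ.congr_deriv ?_
  have hD' := hD
  unfold soloInformedTriplingDen soloInformedTriplingA soloInformedTriplingP at hD'
  unfold soloInformedTripling' soloInformedTriplingWr soloInformedTriplingDen
    soloInformedTriplingA soloInformedTriplingP
  rw [div_left_inj' (pow_ne_zero 2 hD')]
  simp only [Nat.cast_ofNat, show (3 - 1 : ℕ) = 2 from rfl, show (2 - 1 : ℕ) = 1 from rfl,
    pow_one, mul_one]
  ring

/-- `σ` is continuous on `[0, 1]`. [this work] -/
theorem soloInformed_continuousOn_tripling :
    ContinuousOn soloInformedTripling (Icc (0:ℝ) 1) := fun _ ht =>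
  (soloInformed_hasDerivAt_tripling
    (soloInformed_triplingDen_pos ht.1 ht.2).ne').continuousAt.continuousWithinAt

/-- **`σ'(w)² · wQ(w) = 9 · σ(w) Q(σ(w))`** with `Q(w) = (1 − 2w)³ + w³` — the pull-back identity
`[3]^*(dX/y)^{⊗2} = 9 (dX/y)^{⊗2}` read in the coordinate `w` (from the key polynomial identity,
wherever `A + P ≠ 0`). [Silverman, AEC III.5.1; this work] -/
theorem soloInformed_tripling_key {w : ℝ} (hD : soloInformedTriplingDen w ≠ 0) :
    soloInformedTripling' w ^ 2 * (w * ((1 - 2 * w) ^ 3 + w ^ 3)) =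
      9 * (soloInformedTripling w *
        ((1 - 2 * soloInformedTripling w) ^ 3 + soloInformedTripling w ^ 3)) := by
  have hQσ : (1 - 2 * soloInformedTripling w) ^ 3 + soloInformedTripling w ^ 3 =
      ((soloInformedTriplingDen w - 2 * soloInformedTriplingP w) ^ 3 +
        soloInformedTriplingP w ^ 3) / soloInformedTriplingDen w ^ 3 := by
    unfold soloInformedTripling
    field_simp
  rw [hQσ]
  unfold soloInformedTripling' soloInformedTripling
  rw [div_pow, div_mul_eq_mul_div, soloInformed_tripling_ring_identity w]
  field_simp

/-- `σ' ≠ 0` wherever `w ∈ (0,1)` and `σ(w) ∈ (0,1)` (by the key identity: its right-hand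
side is positive there). [this work] -/
theorem soloInformed_tripling'_ne_zero {w : ℝ} (h0 : 0 < w) (h1 : w < 1)
    (hσ : soloInformedTripling w ∈ Ioo (0:ℝ) 1) : soloInformedTripling' w ≠ 0 := by
  intro h
  have hk := soloInformed_tripling_key (soloInformed_triplingDen_pos h0.le h1.le).ne'
  rw [h] at hk
  have h2 : 0 < 1 - 2 * soloInformedTripling w ∨ 0 < soloInformedTripling w := Or.inr hσ.1
  have hq : 0 < (1 - 2 * soloInformedTripling w) ^ 3 + soloInformedTripling w ^ 3 := by
    have e : (1 - 2 * soloInformedTripling w) ^ 3 + soloInformedTripling w ^ 3 =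
        (1 - soloInformedTripling w) * (7 * soloInformedTripling w ^ 2 -
          5 * soloInformedTripling w + 1) := by ring
    rw [e]
    exact mul_pos (sub_pos.2 hσ.2) (by nlinarith [sq_nonneg (soloInformedTripling w - 5 / 14)])
  have : 0 < 9 * (soloInformedTripling w *
      ((1 - 2 * soloInformedTripling w) ^ 3 + soloInformedTripling w ^ 3)) := by
    have := hσ.1
    positivity
  linarith

end Summit.KontsevichZagierPeriods.KontsevichZagierPeriods.Theorems

end
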